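import Summits.QuantumFields.BalabanUV.T4Continuum.Support.SubstrateLocalRateOn

/-!
# RegularTowerSecondOrderWitness — row NE5, located junction J-avg-reg (T4-DAG §8 Q49 (b)): THE FIRST-ORDER (3.35)-SHAPE
# LETTERS DO NOT CONTROL THE DERIVATIVE TOWER — a kernel SEPARATION WITNESS for the displayed second-order letter (ℓ2) `hlipD`

Cell `pub-balaban`, NE5 formalisation swarm, unit `b2b-balaban-t4-ne5-formalise-leaf-08` (gen 19).  Summits-side NEW WORK under the
LEAN PLACEMENT RULE: an explicit [folklore] witness on OUR abstract transporter towers (`RegularBackgroundTower` currency); 0 `Prop`-fact,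
0 citation tag, nothing printed asserted.  HONEST FRAMING: rung (B)+1 of the FINITE-VOLUME T⁴ programme — NOT infinite volume, NOT a
mass gap, NOT the Clay problem, NOT a statement about Bałaban's configurations; NE5 ∕ NE2 NOT PRINTED ∕ NOT PROVED; spine 0∕9.
HONEST DEPENDENCY (cell, verbatim): continuum YM on T⁴ ⇐ BetaPertH ∧ nine spine estimates (0/9 proved); BetaPertH ⇐ (D1) ∧ (D4) ∧
CAP+tail; G-an2-4 gates asym, D1 and NE2/3/4.

WHAT.  Row NE2's bridge `NE2FromNE3BavgBridge.localRate_regClass_of_bavg_consistent` (the producer of the `hloc` letter of NE5's W1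
chain after R58) DISPLAYS, besides the (3.35)-shape class `RegularTransporters L M R α β` (size `α`, lattice-Lipschitz `β∕lev L k`),
the SECOND-ORDER letter (ℓ2)
`hlipD : ∀ k μ ν i, ‖dconnTower L M R k μ (τ_ν i) − dconnTower L M R k μ i‖ ≤ βD ∕ lev L k`
on the DERIVATIVE tower `D_μ w_μ = lev L k • (w_μ − w_μ ∘ τ_μ⁻¹)`.  This file proves that NO `βD` serves (ℓ2) uniformly over the
regular class: for every `β > 0`, every `L > 1` and every direction `μ₀` with an even period `M μ₀` (the cell's tori have
`M = unitMod P = 2·L^m`), and every candidate `βD`, there is a tower `R` with `RegularTransporters L M R (β∕2) β` violating (ℓ2)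
(`no_uniform_hlipD`, §3) — and, sharper, NO `C` serves the W1 letter ITSELF, `LocalRateOn (levelWindow K′) (bgReadings (regClass R)) C L⁻¹`
(ROOT B's own parent-bond reading, W-26's window), uniformly over the class (`no_uniform_localRateOn_regClass`, §4): the obstruction sits in the
CONCLUSION of row NE2's bridge, inside the level window.  The witness is the ZIGZAG tower (`zigzag`): `R ≡ 1` except at ONE level `K` in ONE direction `μ₀`, where
`R^{(K)}_{μ₀}(x) = (1 + ε·(−1)^{x_{μ₀}})·1`, `ε = β∕(2·(lev L K)²)`; its letters are `α = β∕(2·lev L K) ≤ β∕2`, Lipschitz EXACTLY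
`β∕lev L K`, while its derivative tower jumps by EXACTLY `2β` between neighbours (`norm_dconnTower_zigzag_jump`) — so (ℓ2) forces
`βD ≥ 2β·lev L K = 2β·L^K`, unbounded in `K`.
WHY IT MATTERS (located note F-ne5leaf08g19-1, HOME/GAPS.md § G-ne5leaf08g19-1).  At the finest level `k = K` of the averaging tower of
record `towerOf P ι (avgTower ℰ V)` the transporters ARE the window field `V` read through `ι` (substrate W-25 PART 3 `fin_eq_clause`,
`towerOf_chart`), so (ℓ2) at `k = K` is a condition on `V` ALONE: `(L^K)³·‖∂_ν ∂_μ⁻ (ιV)‖ ≤ βD` — Bałaban's (3.36)-SHAPE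
second-difference letter ([Balaban1985BackgroundPropagators] p.396, KIND), which the (α′, β′) window letters of record (size +
Lipschitz, (3.35)-SHAPE) do not imply; the zigzag computation above, with `e^{±iθ}` in place of `1 ± ε`, is a window field.
Hence the displayed binder `hlipD` of W-25b §2 `hloc_avgTower_on_levelWindow[_dom]` is NOT inhabitable K-uniformly when `dom` is the
(α′, β′)-window; a third finest letter β″ (second differences `≤ β″∕(L^K)³` in lattice units `L^K`) — or print's route [Balaban1985RegularSpaces]
(1.7)–(1.9) ⟹ (3.35)–(3.36) by gauge fixing — is what (ℓ2)(ℓ4) need.  Nothing of that is asserted here.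
0 sorry; axioms ⊆ {propext, Classical.choice, Quot.sound}.
-/

noncomputable section

open scoped Matrix Matrix.Norms.L2Operator

namespace Summit.QuantumFields.BalabanUV.T4Continuum.RegularTowerSecondOrderWitness

open Literature.MathematicalPhysics.QuantumFieldTheory.Balaban1983to89.B5Prop11Plancherel (Tor fine unitVec)
open Literature.MathematicalPhysics.QuantumFieldTheory.Balaban1983to89.B5G183RateUnitTower (lev lev_neZero)
open Summit.QuantumFields.BalabanUV.T4Continuum.BalabanAveragedTowerUnit (idx one_le_lev' cast_lev')
open Summit.QuantumFields.BalabanUV.T4Continuum.BlockPairingGeometry (tau)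
open Summit.QuantumFields.BalabanUV.T4Continuum.AbelianCovariantLaplacian (tauInv)
open Summit.QuantumFields.BalabanUV.T4Continuum.RegularBackgroundTower (RegularTransporters connTower dconnTower regClass connTower_eq)
open Summit.QuantumFields.BalabanUV.T4Continuum.NE2FromNE3 (bgReadings entryAt pt)
open Summit.QuantumFields.BalabanUV.T4Continuum.SubstrateLocalRateOn (LocalRateOn levelWindow)

/-! ## §1 The zigzag sign `(−1)^x` on an even cyclic group -/

section Parity

variable {n : ℕ}

/-- [folklore] the parity character `ℤ∕n → ℤ∕2` for even `n`. -/
def par (h2 : 2 ∣ n) : ZMod n →+* ZMod 2 := ZMod.castHom h2 (ZMod 2)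

/-- [folklore] the zigzag sign `(−1)^x` on `ℤ∕n`, `n` even. -/
def sgn (h2 : 2 ∣ n) (x : ZMod n) : ℝ := if par h2 x = 0 then 1 else -1

/-- [folklore] `|(−1)^x| = 1`. -/
theorem abs_sgn (h2 : 2 ∣ n) (x : ZMod n) : |sgn h2 x| = 1 := by
  unfold sgn; split_ifs <;> simp

/-- [folklore] one step flips the sign: `(−1)^{x+1} = −(−1)^x` (this is where evenness of `n` enters). -/
theorem sgn_add_one (h2 : 2 ∣ n) (x : ZMod n) : sgn h2 (x + 1) = -sgn h2 x := by
  have h : par h2 (x + 1) = par h2 x + 1 := by rw [map_add, map_one]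
  have hcases : ∀ y : ZMod 2, y = 0 ∨ y = 1 := by decide
  have h10 : (1 : ZMod 2) ≠ 0 := by decide
  have h11 : (1 : ZMod 2) + 1 = 0 := by decide
  unfold sgn
  rw [h]
  rcases hcases (par h2 x) with hy | hy
  · rw [hy, zero_add, if_neg h10, if_pos rfl]
  · rw [hy, if_pos h11, if_neg h10, neg_neg]

/-- [folklore] … and so does one step back: `(−1)^{x−1} = −(−1)^x`. -/
theorem sgn_sub_one (h2 : 2 ∣ n) (x : ZMod n) : sgn h2 (x - 1) = -sgn h2 x := by
  have h := sgn_add_one h2 (x - 1)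
  rw [sub_add_cancel] at h
  rw [h, neg_neg]

end Parity

/-! ## §2 The zigzag tower and its letters -/

section Zigzag

variable {d : ℕ} (L : ℕ) (M : Fin d → ℕ) (o : Type*) [DecidableEq o]

/-- [folklore] the level-`k` period in direction `μ₀` is even as soon as `M μ₀` is. -/
theorem two_dvd_fine {μ₀ : Fin d} (hM2 : 2 ∣ M μ₀) (k : ℕ) : 2 ∣ fine (lev L k) M μ₀ :=
  Dvd.dvd.mul_left hM2 _

/-- [folklore] the level-`k` zigzag sign `s_k(i) = (−1)^{(i.1) μ₀}`. -/
def lsgn (μ₀ : Fin d) (hM2 : 2 ∣ M μ₀) (k : ℕ) (i : idx L M k) : ℝ :=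
  sgn (two_dvd_fine L M hM2 k) (i.1 μ₀)

/-- [folklore] the scalar coefficient of the witness: `ε·s_K(i)` at level `K` in direction `μ₀`, `0` elsewhere. -/
def coef (μ₀ : Fin d) (hM2 : 2 ∣ M μ₀) (K : ℕ) (ε : ℝ) (k : ℕ) (μ : Fin d) (i : idx L M k) : ℝ :=
  if k = K ∧ μ = μ₀ then ε * lsgn L M μ₀ hM2 k i else 0

/-- [folklore] **THE ZIGZAG TOWER** `R^{(k)}_μ(i) = (1 + coef k μ i)·1`: identically `1` except at level `K` in direction `μ₀`,
where `R = (1 + ε·(−1)^{x_{μ₀}})·1`. -/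
def zigzag (μ₀ : Fin d) (hM2 : 2 ∣ M μ₀) (K : ℕ) (ε : ℝ) : (k : ℕ) → Fin d → idx L M k → Matrix o o ℂ :=
  fun k μ i => ((1 + coef L M μ₀ hM2 K ε k μ i : ℝ) : ℂ) • (1 : Matrix o o ℂ)

variable {L M}
variable {μ₀ : Fin d} {hM2 : 2 ∣ M μ₀} {K : ℕ} {ε : ℝ}

/-- [folklore] the sign flips along `μ₀`. -/
theorem lsgn_tau_same (k : ℕ) (i : idx L M k) :
    lsgn L M μ₀ hM2 k (tau (fine (lev L k) M) μ₀ i) = -lsgn L M μ₀ hM2 k i := by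
  have h : (tau (fine (lev L k) M) μ₀ i).1 μ₀ = i.1 μ₀ + 1 := by
    simp [BlockPairingGeometry.tau, unitVec]
  unfold lsgn
  rw [h, sgn_add_one]

/-- [folklore] … and back. -/
theorem lsgn_tauInv_same (k : ℕ) (i : idx L M k) :
    lsgn L M μ₀ hM2 k (tauInv (fine (lev L k) M) μ₀ i) = -lsgn L M μ₀ hM2 k i := by
  have h : (tauInv (fine (lev L k) M) μ₀ i).1 μ₀ = i.1 μ₀ - 1 := by
    simp [AbelianCovariantLaplacian.tauInv, unitVec]
  unfold lsgn
  rw [h, sgn_sub_one]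

/-- [folklore] the sign is constant along the other directions. -/
theorem lsgn_tau_ne (k : ℕ) {μ : Fin d} (hμ : μ ≠ μ₀) (i : idx L M k) :
    lsgn L M μ₀ hM2 k (tau (fine (lev L k) M) μ i) = lsgn L M μ₀ hM2 k i := by
  have h : (tau (fine (lev L k) M) μ i).1 μ₀ = i.1 μ₀ := by
    simp [BlockPairingGeometry.tau, unitVec, Pi.single_eq_of_ne (Ne.symm hμ)]
  unfold lsgn
  rw [h]

/-- [folklore] `|s_k(i)| = 1`. -/
theorem abs_lsgn (k : ℕ) (i : idx L M k) : |lsgn L M μ₀ hM2 k i| = 1 := abs_sgn _ _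

/-- [folklore] scalar bookkeeping: `(ℓ : ℂ) • ((r : ℂ) • 1) = ((ℓ·r : ℝ) : ℂ) • 1`. -/
theorem natCast_smul_real_smul_one (ℓ : ℕ) (r : ℝ) :
    ((ℓ : ℕ) : ℂ) • (((r : ℝ) : ℂ) • (1 : Matrix o o ℂ)) = (((ℓ : ℝ) * r : ℝ) : ℂ) • (1 : Matrix o o ℂ) := by
  rw [smul_smul, Complex.ofReal_mul, Complex.ofReal_natCast]

/-- [folklore] `‖(r : ℂ) • 1‖ = |r|` in the `ℓ²`-operator norm (`‖1‖ = 1` on the C⋆-algebra of matrices, `o` nonempty). -/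
theorem norm_real_smul_one [Fintype o] [Nonempty o] (r : ℝ) : ‖((r : ℝ) : ℂ) • (1 : Matrix o o ℂ)‖ = |r| := by
  rw [norm_smul, Complex.norm_real, Real.norm_eq_abs, norm_one, mul_one]

/-- [folklore] `R − 1 = coef • 1`. -/
theorem zigzag_sub_one (k : ℕ) (μ : Fin d) (i : idx L M k) :
    zigzag L M o μ₀ hM2 K ε k μ i - 1 = ((coef L M μ₀ hM2 K ε k μ i : ℝ) : ℂ) • (1 : Matrix o o ℂ) := by
  unfold zigzag
  rw [Complex.ofReal_add, Complex.ofReal_one, add_smul, one_smul, add_sub_cancel_left]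

/-- [folklore] `R(j) − R(i) = (coef j − coef i) • 1`. -/
theorem zigzag_sub_zigzag (k : ℕ) (μ : Fin d) (i j : idx L M k) :
    zigzag L M o μ₀ hM2 K ε k μ j - zigzag L M o μ₀ hM2 K ε k μ i
      = ((coef L M μ₀ hM2 K ε k μ j - coef L M μ₀ hM2 K ε k μ i : ℝ) : ℂ) • (1 : Matrix o o ℂ) := by
  unfold zigzag
  rw [← sub_smul, ← Complex.ofReal_sub, add_sub_add_left_eq_sub]

/-- [folklore] the connection tower of the witness: `w^{(k)}_μ(i) = (lev L k · coef k μ i)·1`. -/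
theorem connTower_zigzag (k : ℕ) (μ : Fin d) (i : idx L M k) :
    connTower L M (zigzag L M o μ₀ hM2 K ε) k μ i = ((((lev L k : ℕ) : ℝ) * coef L M μ₀ hM2 K ε k μ i : ℝ) : ℂ) • (1 : Matrix o o ℂ) := by
  rw [connTower_eq, zigzag_sub_one, natCast_smul_real_smul_one]

/-- [folklore] the derivative tower of the witness: `D_μ w_μ (i) = (lev L k)²·(coef i − coef (τ_μ⁻¹ i))·1`. -/
theorem dconnTower_zigzag (k : ℕ) (μ : Fin d) (i : idx L M k) :
    dconnTower L M (zigzag L M o μ₀ hM2 K ε) k μ i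
      = ((((lev L k : ℕ) : ℝ) ^ 2 * (coef L M μ₀ hM2 K ε k μ i - coef L M μ₀ hM2 K ε k μ (tauInv (fine (lev L k) M) μ i)) : ℝ) : ℂ)
          • (1 : Matrix o o ℂ) := by
  simp only [RegularBackgroundTower.dconnTower, connTower_zigzag]
  rw [← sub_smul, ← Complex.ofReal_sub, ← mul_sub, natCast_smul_real_smul_one, ← mul_assoc, sq]

/-- [folklore] the coefficient at the active level∕direction. -/
theorem coef_active (i : idx L M K) : coef L M μ₀ hM2 K ε K μ₀ i = ε * lsgn L M μ₀ hM2 K i := by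
  simp [coef]

/-- [folklore] the coefficient off the active level∕direction vanishes. -/
theorem coef_inactive {k : ℕ} {μ : Fin d} (h : ¬(k = K ∧ μ = μ₀)) (i : idx L M k) : coef L M μ₀ hM2 K ε k μ i = 0 := by
  simp [coef, h]

/-- [folklore] **THE (3.35)-SHAPE LETTERS OF THE ZIGZAG TOWER**: with `ε = β∕(2·(lev L K)²)` it lies in the regular class
`RegularTransporters L M R (β∕2) β` — size `lev L K · ε = β∕(2·lev L K) ≤ β∕2`, lattice-Lipschitz EXACTLY `β∕lev L K` along `μ₀`
(the sign flips at every step) and `0` elsewhere. -/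
theorem zigzag_regular [NeZero L] [Fintype o] [Nonempty o] {β : ℝ} (hβ : 0 ≤ β) :
    RegularTransporters L M (zigzag L M o μ₀ hM2 K (β / (2 * ((lev L K : ℕ) : ℝ) ^ 2))) (β / 2) β := by
  have hℓ1 : ∀ k, (1 : ℝ) ≤ ((lev L k : ℕ) : ℝ) := fun k => by exact_mod_cast one_le_lev' L k
  have hℓ0 : ∀ k, (0 : ℝ) < ((lev L k : ℕ) : ℝ) := fun k => lt_of_lt_of_le one_pos (hℓ1 k)
  refine ⟨⟨by linarith, hβ⟩, fun k ν i => ?_, fun k ν μ i => ?_⟩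
  · -- size
    rw [zigzag_sub_one, natCast_smul_real_smul_one, norm_real_smul_one o]
    by_cases h : k = K ∧ ν = μ₀
    · obtain ⟨rfl, rfl⟩ := h
      rw [coef_active, abs_mul, abs_mul, abs_lsgn, mul_one, abs_of_pos (hℓ0 k), abs_of_nonneg (by positivity)]
      calc ((lev L k : ℕ) : ℝ) * (β / (2 * ((lev L k : ℕ) : ℝ) ^ 2)) = β / 2 / ((lev L k : ℕ) : ℝ) := by
            field_simp
        _ ≤ β / 2 := div_le_self (by linarith) (hℓ1 k)
    · rw [coef_inactive h, mul_zero, abs_zero]; linarith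
  · -- lattice Lipschitz
    rw [zigzag_sub_zigzag, natCast_smul_real_smul_one, norm_real_smul_one o]
    by_cases h : k = K ∧ ν = μ₀
    · obtain ⟨rfl, rfl⟩ := h
      rw [coef_active, coef_active]
      by_cases hμ : μ = ν
      · subst hμ
        rw [lsgn_tau_same, abs_mul, abs_of_pos (hℓ0 k),
          show β / (2 * ((lev L k : ℕ) : ℝ) ^ 2) * -lsgn L M μ hM2 k i - β / (2 * ((lev L k : ℕ) : ℝ) ^ 2) * lsgn L M μ hM2 k i
            = -(2 * (β / (2 * ((lev L k : ℕ) : ℝ) ^ 2)) * lsgn L M μ hM2 k i) by ring,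
          abs_neg, abs_mul, abs_lsgn, mul_one, abs_of_nonneg (by positivity)]
        apply le_of_eq
        field_simp
      · rw [lsgn_tau_ne k hμ, sub_self, mul_zero, abs_zero]; positivity
    · rw [coef_inactive h, coef_inactive h, sub_self, mul_zero, abs_zero]; positivity

/-- [folklore] **THE DERIVATIVE TOWER OF THE WITNESS AT THE ACTIVE LEVEL**: `D_{μ₀} w_{μ₀}(i) = β·(−1)^{i_{μ₀}}·1`. -/
theorem dconnTower_zigzag_active [NeZero L] {β : ℝ} (i : idx L M K) :
    dconnTower L M (zigzag L M o μ₀ hM2 K (β / (2 * ((lev L K : ℕ) : ℝ) ^ 2))) K μ₀ i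
      = ((β * lsgn L M μ₀ hM2 K i : ℝ) : ℂ) • (1 : Matrix o o ℂ) := by
  have hℓ0 : (0 : ℝ) < ((lev L K : ℕ) : ℝ) := by exact_mod_cast one_le_lev' L K
  rw [dconnTower_zigzag, coef_active, coef_active, lsgn_tauInv_same]
  congr 2
  field_simp
  ring

/-- [folklore] **THE JUMP**: the derivative tower of the witness changes by EXACTLY `2β` between `μ₀`-neighbours at level `K`
(while its (3.35)-letters are `(β∕2, β)`, `zigzag_regular`). -/
theorem norm_dconnTower_zigzag_jump [NeZero L] [Fintype o] [Nonempty o] {β : ℝ} (hβ : 0 ≤ β) (i : idx L M K) :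
    ‖dconnTower L M (zigzag L M o μ₀ hM2 K (β / (2 * ((lev L K : ℕ) : ℝ) ^ 2))) K μ₀ (tau (fine (lev L K) M) μ₀ i)
        - dconnTower L M (zigzag L M o μ₀ hM2 K (β / (2 * ((lev L K : ℕ) : ℝ) ^ 2))) K μ₀ i‖ = 2 * β := by
  rw [dconnTower_zigzag_active, dconnTower_zigzag_active, lsgn_tau_same, ← sub_smul, ← Complex.ofReal_sub, norm_real_smul_one o,
    show β * -lsgn L M μ₀ hM2 K i - β * lsgn L M μ₀ hM2 K i = -(2 * β * lsgn L M μ₀ hM2 K i) by ring, abs_neg, abs_mul, abs_lsgn,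
    mul_one, abs_of_nonneg (by positivity)]

/-- [folklore] **(ℓ2) FAILS FOR THE WITNESS as soon as `βD < 2β·lev L K`**. -/
theorem not_hlipD_zigzag [NeZero L] [Fintype o] [Nonempty o] {β βD : ℝ} (hβ : 0 ≤ β)
    (hlt : βD < 2 * β * ((lev L K : ℕ) : ℝ)) :
    ¬ ∀ (k : ℕ) (μ ν : Fin d) (i : idx L M k),
        ‖dconnTower L M (zigzag L M o μ₀ hM2 K (β / (2 * ((lev L K : ℕ) : ℝ) ^ 2))) k μ (tau (fine (lev L k) M) ν i)
          - dconnTower L M (zigzag L M o μ₀ hM2 K (β / (2 * ((lev L K : ℕ) : ℝ) ^ 2))) k μ i‖ ≤ βD / ((lev L k : ℕ) : ℝ) := by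
  intro h
  have hℓ0 : (0 : ℝ) < ((lev L K : ℕ) : ℝ) := by exact_mod_cast one_le_lev' L K
  have h1 := h K μ₀ μ₀ ((fun _ => 0), μ₀)
  rw [norm_dconnTower_zigzag_jump o hβ, le_div_iff₀ hℓ0] at h1
  linarith

end Zigzag

/-! ## §3 END: no `βD` serves (ℓ2) uniformly over the (3.35)-shape class -/

section End

variable {d : ℕ} (L : ℕ) [NeZero L] (M : Fin d → ℕ) (o : Type*) [Fintype o] [DecidableEq o] [Nonempty o]

/-- [folklore] **NO LEVEL-UNIFORM SECOND-ORDER LETTER FROM FIRST-ORDER REGULARITY**: for `β > 0`, `L > 1` and a direction `μ₀` of even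
period, there is NO constant `βD` such that every tower of the (3.35)-shape class `RegularTransporters L M R (β∕2) β` satisfies the
displayed (ℓ2) letter `hlipD` of `NE2FromNE3BavgBridge.localRate_regClass_of_bavg_consistent` — the zigzag tower at a level `K` with
`2β·L^K > βD` is regular with those letters and violates it.  (The connection member needs no such letter: `connTower_lipschitz`.) -/
theorem no_uniform_hlipD {β : ℝ} (hβ : 0 < β) (hL : 1 < L) (μ₀ : Fin d) (hM2 : 2 ∣ M μ₀) :
    ¬ ∃ βD : ℝ, ∀ R : (k : ℕ) → Fin d → idx L M k → Matrix o o ℂ, RegularTransporters L M R (β / 2) β →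
        ∀ (k : ℕ) (μ ν : Fin d) (i : idx L M k),
          ‖dconnTower L M R k μ (tau (fine (lev L k) M) ν i) - dconnTower L M R k μ i‖ ≤ βD / ((lev L k : ℕ) : ℝ) := by
  rintro ⟨βD, h⟩
  have hL' : (1 : ℝ) < (L : ℝ) := by exact_mod_cast hL
  obtain ⟨K, hK⟩ := pow_unbounded_of_one_lt (βD / (2 * β)) hL'
  have hlt : βD < 2 * β * ((lev L K : ℕ) : ℝ) := by
    rw [cast_lev']
    rwa [div_lt_iff₀' (by positivity)] at hK
  exact not_hlipD_zigzag (L := L) (M := M) (o := o) (μ₀ := μ₀) (hM2 := hM2) (K := K) hβ.le hlt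
    (h _ (zigzag_regular (L := L) (M := M) (o := o) (μ₀ := μ₀) (hM2 := hM2) (K := K) hβ.le))

end End

/-! ## §4 END′: the obstruction sits in the CONCLUSION — no uniform constant for the (windowed) `hloc` of `regClass` either -/

section HlocLemmas

variable {d : ℕ} {L : ℕ} {M : Fin d → ℕ} {o : Type*} [DecidableEq o]
variable {μ₀ : Fin d} {hM2 : 2 ∣ M μ₀} {K : ℕ}

/-- [folklore] off the active level the derivative tower of the witness vanishes. -/
theorem dconnTower_zigzag_inactive {ε : ℝ} {k : ℕ} (hk : k ≠ K) (μ : Fin d) (i : idx L M k) :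
    dconnTower L M (zigzag L M o μ₀ hM2 K ε) k μ i = 0 := by
  have h : ¬(k = K ∧ μ = μ₀) := fun h' => hk h'.1
  rw [dconnTower_zigzag, coef_inactive h, coef_inactive h, sub_self, mul_zero, Complex.ofReal_zero, zero_smul]

/-- [folklore] a diagonal entry of the active derivative tower of the witness is `±β`. -/
theorem re_dconnTower_zigzag_active_apply [NeZero L] {β : ℝ} (i : idx L M K) (a : o) :
    |(dconnTower L M (zigzag L M o μ₀ hM2 K (β / (2 * ((lev L K : ℕ) : ℝ) ^ 2))) K μ₀ i a a).re| = |β| := by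
  rw [dconnTower_zigzag_active, Matrix.smul_apply, Matrix.one_apply_eq, smul_eq_mul, mul_one, Complex.ofReal_re, abs_mul, abs_lsgn,
    mul_one]

end HlocLemmas

section Hloc

variable {d : ℕ} (L : ℕ) [NeZero L] (M : Fin d → ℕ)
variable (o : Type*) [Fintype o] [DecidableEq o] [Nonempty o]

omit [Fintype o] in
/-- [folklore] **THE WINDOWED `hloc` OF `regClass` FAILS FOR THE WITNESS** at the pair `(K, K+1)` of `levelWindow (K+1)` as soon as `C < β·L^K`:
the derivative member is `0` at level `K` and `±β·1` at level `K + 1`, so ROOT B's local reading jumps by `β` where `C·L^{−K}` is allowed. -/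
theorem not_localRateOn_zigzag {μ₀ : Fin d} {hM2 : 2 ∣ M μ₀} {K : ℕ} {β C : ℝ} (hβ : 0 ≤ β) (hlt : C < β * ((lev L K : ℕ) : ℝ)) :
    ¬ LocalRateOn (levelWindow (K + 1))
        (bgReadings L M (regClass L M (zigzag L M o μ₀ hM2 (K + 1) (β / (2 * ((lev L (K + 1) : ℕ) : ℝ) ^ 2))))) C ((L : ℝ)⁻¹) := by
  intro h
  obtain ⟨a⟩ := ‹Nonempty o›
  have hℓ0 : (0 : ℝ) < ((lev L K : ℕ) : ℝ) := by exact_mod_cast one_le_lev' L K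
  have hmem : dconnTower L M (zigzag L M o μ₀ hM2 (K + 1) (β / (2 * ((lev L (K + 1) : ℕ) : ℝ) ^ 2)))
      ∈ (bgReadings L M (regClass L M (zigzag L M o μ₀ hM2 (K + 1) (β / (2 * ((lev L (K + 1) : ℕ) : ℝ) ^ 2))))).dom :=
    Or.inr rfl
  have h1 := h K (le_refl (K + 1)) _ hmem ⟨fun _ => 0, fun _ _ => 0, μ₀, μ₀, a, a, true⟩
  simp only [bgReadings, if_true, entryAt] at h1
  rw [dconnTower_zigzag_inactive (Nat.succ_ne_self K).symm, Matrix.zero_apply, Complex.zero_re, sub_zero,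
    re_dconnTower_zigzag_active_apply, abs_of_nonneg hβ, inv_pow, ← cast_lev', ← div_eq_mul_inv, le_div_iff₀ hℓ0] at h1
  linarith

/-- [folklore] **NO LEVEL-UNIFORM CONSTANT FOR THE W1 LETTER `hloc` OF `regClass` FROM FIRST-ORDER REGULARITY** — the obstruction of §3 sits
in the CONCLUSION of row NE2's bridge, not only in its `hlipD` hypothesis, and INSIDE the level window of W-26 (the pair `(K, K+1)` of
`levelWindow (K+1)`): for `β > 0`, `L > 1` and a direction of even period there is NO `C` with
`LocalRateOn (levelWindow K′) (bgReadings (regClass R)) C L⁻¹` for every `K′` and every tower of the class `RegularTransporters L M R (β∕2) β`. -/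
theorem no_uniform_localRateOn_regClass {β : ℝ} (hβ : 0 < β) (hL : 1 < L) (μ₀ : Fin d) (hM2 : 2 ∣ M μ₀) :
    ¬ ∃ C : ℝ, ∀ (K' : ℕ) (R : (k : ℕ) → Fin d → idx L M k → Matrix o o ℂ), RegularTransporters L M R (β / 2) β →
        LocalRateOn (levelWindow K') (bgReadings L M (regClass L M R)) C ((L : ℝ)⁻¹) := by
  rintro ⟨C, h⟩
  have hL' : (1 : ℝ) < (L : ℝ) := by exact_mod_cast hL
  obtain ⟨K, hK⟩ := pow_unbounded_of_one_lt (C / β) hL'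
  have hlt : C < β * ((lev L K : ℕ) : ℝ) := by
    rw [cast_lev']
    rwa [div_lt_iff₀' hβ] at hK
  exact not_localRateOn_zigzag L M o (μ₀ := μ₀) (hM2 := hM2) hβ.le hlt
    (h (K + 1) _ (zigzag_regular (L := L) (M := M) (o := o) (μ₀ := μ₀) (hM2 := hM2) (K := K + 1) hβ.le))

end Hloc

end Summit.QuantumFields.BalabanUV.T4Continuum.RegularTowerSecondOrderWitness

end
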